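import Summits.ResolutionOfSingularities.ResolutionOfSingularities.Theorems.UniformComplexityCampaignW82FamilyResolutionSep
import Summits.ResolutionOfSingularities.ResolutionOfSingularities.Theorems.UniformComplexityCampaignW82FamilyResolutionGraded
import Mathlib.Topology.KrullDimension
import HarnessLib

/-!
# [OURS · L1 W8.2] RESOLUTION IN FAMILIES WITH SEPARABLE BASE EXTENSIONS, GRADED BY THE FIBRE DIMENSION —
# door 2 (`UniformComplexity` / `PrimeModelTransfer`) of slot W8.2; campaign statements, Theses-free module

Cell `res-hironaka` (run/shared/lean/pub/res-hironaka/), LADDER-RESOLUTION rung L (RESCUE), slot W8.2 of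
plan/RESCUE-SEED.md, door 2: route `UniformComplexity`, item `PrimeModelTransfer`
(stmt-ResolutionOfSingularities-8933). Sequel of the OURS modules `…FamilyResolutionSep.lean` (p554368:
`CampaignW82.FamilyResolutionSep k`, refuted for every `k` of characteristic `p` by the prover's
`SeparableTightness.not_familyResolutionSep`) and `…FamilyResolutionGraded.lean` (p531166:
`CampaignW82.FamilyResolutionDimLe k n`, PROVED at `n = 1` for every field, `familyResolutionDimLe_one`, p531789).
Self-typed by the slot's prover res-L1-s82-pv-2 (gen 7) under the rung-B precedent; NOTHING is proved about
resolution of singularities here: one `def` and three pure-logic anchors.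

WHY THIS FILE. The separable tightness (`not_familyResolutionSep`) is witnessed by a family of CURVES (the
compactified Kollár pencil `y^q = x^p − t` over `k[t]`, geometric generic fibre of dimension `1`), while
resolution in families HOLDS for families of curves over every field (`familyResolutionDimLe_one`). To state that
dichotomy IN ONE GRADE — «in fibre dimension `1`, resolution in families holds, and never with separable base
extensions» — one needs the separable variant graded by the fibre dimension exactly as `FamilyResolutionDimLe`
grades `FamilyResolution`:

* `FamilyResolutionSepDimLe k n` — verbatim `FamilyResolutionDimLe k n` (hypothesis: geometric generic fibre
  integral of `topologicalKrullDim ≤ n`) with the separability conjunct of `FamilyResolutionSep k`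
  (`Algebra.FormallyUnramified (FractionRing A) (FractionRing A ⊗[A] A')`) in the conclusion.

Anchors (pure logic): `familyResolutionSep_iff_familyResolutionSepDimLe_top`, `familyResolutionSepDimLe_anti`,
`familyResolutionDimLe_of_familyResolutionSepDimLe`. Intended theorem (res-L1-s82-pv-2 gen 7, sibling
`…SeparableTightnessGraded.lean`): `∀ k` of characteristic `p`, `¬ FamilyResolutionSepDimLe k 1` (hence `¬` in
every grade `n ≥ 1`), next to `familyResolutionDimLe_one k : FamilyResolutionDimLe k 1`.

HONEST FRAMING. The `def` below is OURS — a campaign statement that REPLACES THE ROLE of a printed item of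
H. Hironaka's manuscript *Resolution of singularities in positive characteristics* (2017-03-23, [Hironaka2017],
lit key `paper:url-3343fd9e678b`) — §17 ¶2, p.89 l.59–62 (the variety over a field of transcendence degree `d`
as a FAMILY «of dimension d + dim Z» over the prime field; typed AS PRINTED as `S17Methodology.U89_3`) — on the
NEGATIVE side and graded by `dim Z`; NOT a statement of the manuscript. Hironaka's statements are CANDIDATES under
adjudication (D-0012/D-0089); nothing here is attributed to the author and no verdict on the manuscript is implied.
AI typing, weaker than expert review.

VACUITY SELF-CHECK. `FamilyResolutionSepDimLe k n` is a strengthening of `FamilyResolutionDimLe k n` (anchor);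
at `n = ⊤` it is `FamilyResolutionSep k` (anchor); trivially true at `n = ⊥` only (integral schemes are
non-empty, so no family satisfies the hypothesis); for `k` of characteristic `p` and `n ≥ 1` it is REFUTED by the
prover (the informative content of a graded tightness statement); in characteristic `0` the conjunct is idle.

## References (vocabulary and locators only; nothing cited as a premise)
* H. Hironaka, ms. 2017-03-23, §17 ¶2 p.89 l.59–62 — under adjudication, role only. [Hironaka2017]
* J. Kollár, *Lectures on Resolution of Singularities* (2007), 1.19. [Kollar2007]
* Theorems/UniformComplexityCampaignW82FamilyResolution{,Sep,Graded}.lean (p526769, p554368, p531166) — OURS.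
-/

noncomputable section

set_option linter.dupNamespace false -- mandated namespace of this single-conjunct summit

open _root_.CategoryTheory _root_.CategoryTheory.Limits _root_.AlgebraicGeometry
open scoped TensorProduct

namespace Summit.ResolutionOfSingularities.ResolutionOfSingularities.Theorems.CampaignW82

/-- [OURS · L1 W8.2 door 2, graded tightness] replaces the role of §17 ¶2, p.89 l.59–62 («dimension
d + dim Z»; `S17Methodology.U89_3`) on the NEGATIVE side, graded by the fibre dimension; NOT a statement of the
manuscript. **RESOLUTION IN FAMILIES over `k` WITH SEPARABLE BASE EXTENSIONS, in fibre dimension `≤ n`**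
(`n : WithBot ℕ∞`): for every finitely generated `k`-domain `A` and every PROPER `f : 𝒳 → Spec A` whose geometric
generic fibre `𝒳 ×_A Spec (Frac A)^{alg}` is INTEGRAL and of `topologicalKrullDim ≤ n`, there are a domain `A'`
with an injective, finite-type, algebraic `A`-algebra structure WHOSE GENERIC FIBRE IS FORMALLY UNRAMIFIED over
`Frac A` (`Algebra.FormallyUnramified (FractionRing A) (FractionRing A ⊗[A] A')`: `Frac A'/Frac A` separable,
i.e. a generically étale base change) and ONE morphism `G : 𝒴 → 𝒳 ×_A Spec A'` whose fibre over every
field-valued point `A' → Ω` is a weak resolution (`CampaignW82.IsWeakResolution`). Verbatim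
`FamilyResolutionDimLe k n` (p531166) with the separability conjunct of `FamilyResolutionSep k` (p554368);
`⊤` gives back `FamilyResolutionSep k`, antitone in `n`, implies `FamilyResolutionDimLe k n` (anchors).
Intended theorem (gen 7): `¬ FamilyResolutionSepDimLe k 1` for every `k` of characteristic `p`, next to
`familyResolutionDimLe_one k` (p531789). Vacuity: see the module docstring. [folklore] -/
def FamilyResolutionSepDimLe (k : Type) [Field k] (n : WithBot ℕ∞) : Prop :=
  ∀ (A : Type) [CommRing A] [IsDomain A] [Algebra k A], Algebra.FiniteType k A →
    ∀ (𝒳 : Scheme.{0}) (f : 𝒳 ⟶ Spec (.of A)), IsProper f →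
      IsIntegral (pullback f (Spec.map (CommRingCat.ofHom
          (algebraMap A (AlgebraicClosure (FractionRing A)))))) →
      topologicalKrullDim ↥(pullback f (Spec.map (CommRingCat.ofHom
          (algebraMap A (AlgebraicClosure (FractionRing A)))))) ≤ n →
      ∃ (A' : Type) (_ : CommRing A') (_ : IsDomain A') (_ : Algebra A A'),
        Function.Injective (algebraMap A A') ∧ Algebra.FiniteType A A' ∧ Algebra.IsAlgebraic A A' ∧
        Algebra.FormallyUnramified (FractionRing A) (FractionRing A ⊗[A] A') ∧
        ∃ (𝒴 : Scheme.{0})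
          (G : 𝒴 ⟶ pullback f (Spec.map (CommRingCat.ofHom (algebraMap A A')))),
          ∀ (Ω : Type) [Field Ω] (φ : A' →+* Ω),
            IsWeakResolution
              (pullback.snd G
                (pullback.fst (pullback.snd f (Spec.map (CommRingCat.ofHom (algebraMap A A'))))
                  (Spec.map (CommRingCat.ofHom φ))))

/-- Anchor (pure logic): the ungraded `FamilyResolutionSep k` is the grade `⊤`. [folklore] -/
theorem familyResolutionSep_iff_familyResolutionSepDimLe_top (k : Type) [Field k] :
    FamilyResolutionSep k ↔ FamilyResolutionSepDimLe k ⊤ :=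
  ⟨fun h A _ _ _ hA 𝒳 f hf hint _ => h A hA 𝒳 f hf hint,
    fun h A _ _ _ hA 𝒳 f hf hint => h A hA 𝒳 f hf hint le_top⟩

/-- Anchor (pure logic): `FamilyResolutionSepDimLe k n` is antitone in `n`. [folklore] -/
theorem familyResolutionSepDimLe_anti (k : Type) [Field k] {m n : WithBot ℕ∞} (hmn : m ≤ n)
    (h : FamilyResolutionSepDimLe k n) : FamilyResolutionSepDimLe k m :=
  fun A _ _ _ hA 𝒳 f hf hint hdim => h A hA 𝒳 f hf hint (hdim.trans hmn)

/-- Anchor (pure logic): dropping the separability conjunct, grade by grade. [folklore] -/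
theorem familyResolutionDimLe_of_familyResolutionSepDimLe (k : Type) [Field k] {n : WithBot ℕ∞}
    (h : FamilyResolutionSepDimLe k n) : FamilyResolutionDimLe k n := by
  intro A _ _ _ hA 𝒳 f hf hint hdim
  obtain ⟨A', _, _, _, hinj, hft, halg, -, 𝒴, G, hG⟩ := h A hA 𝒳 f hf hint hdim
  exact ⟨A', ‹_›, ‹_›, ‹_›, hinj, hft, halg, 𝒴, G, hG⟩

end Summit.ResolutionOfSingularities.ResolutionOfSingularities.Theorems.CampaignW82

end
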